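import Mathlib
import Literature.AlgebraicGeometry.Resolution.CobordantChartCoefficients
import Literature.AlgebraicGeometry.Resolution.CobordantChartPlaneSlice
import Literature.AlgebraicGeometry.Resolution.CobordantTupleGame
import Literature.AlgebraicGeometry.Resolution.FormalCoordinateChange
import Summits.ResolutionOfSingularities.ResolutionOfSingularities.Theorems.WeightedInvariantLocalWeightedDropMultiplicityLift

/-!
# `WeightedInvariant.LocalWeightedDrop`, line `hasse-ridge-face-selection`: TRANSPORT OF THE `y`-FREE COEFFICIENTS
# OF A MONIC FORM UNDER THE POINT BLOW-UP BRICK (the `A₁`-transport, part 1: point chart)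

Crux item stmt-ResolutionOfSingularities-8899 `LocalWeightedDrop` (route `ResolutionOfSingularities/WeightedInvariant`),
serving the door `WeightedConstruction` stmt-ResolutionOfSingularities-0571.  [OURS · L1 W4.3, chain w43, stub worker 2 (gen 2),
CHAIN v2 seat table: the «A₁ transport» helper for the pieces S2s `stub_charTwoSeparableDoublePointWon` / S2i of skeleton v21.
Not a statement of any manuscript.]

In the move bricks `won_monic_of_pointBlowup` / `won_monic_of_curveBlowup` the coefficients `A_j(x') ∈ k[[x'_0, …, x'_{m-1}]]` of a
monic form `y^d + Σ_j A_j y^j` are replaced, at a singular successor, by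
* POINT blow-up at the exceptional point `c`, live slot `i₀` (`c i₀ ≠ 0`): `A_j' = (s · B_j)|_{x'_{i₀} ↦ 0}` where
  `A_j ∘ chart(c) = s^{d-j+1} · B_j` (`chart(c) : x'_l ↦ s (c_l + x'_l)`, `TupleGame.slice i₀` kills `x'_{i₀}` and keeps `s = X 0`);
* CURVE blow-up of `V(x'_i, y)` at `c_i ≠ 0`: `A_j' = c_i^{d-j} · (A'_j ∘ chart_{e_i}(c_i))|_{x'_i ↦ 0}` where `A_j = x_i'^{d-j} A'_j`.

This file computes these transports as far as the next seats need them (no definitions):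
* `coeff_cons_slice_subst_chart` — the coefficient formula of the SLICED POINT CHART
  `A ↦ (A ∘ chart(c))|_{x'_{i₀} ↦ 0}`: the coefficient of `s^b x''^τ` is `Σ_{|d| = b} A_d ∏_l C(d_l, τ♮_l) c_l^{d_l - τ♮_l}`
  (`τ♮` = `τ` with a `0` inserted at `i₀`);
* `X_pow_dvd_slice_subst_chart` / `exists_coeff_slice_subst_chart_ne_zero` — `s^{ord A}` divides the sliced chart image and,
  when `c i₀ ≠ 0`, `s^{ord A + 1}` does not (the top form of `A` dehomogenised at `x_{i₀} = c_{i₀}` survives);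
* `exists_slice_subst_chart_eq` — hence `(A ∘ chart(c))| = s^{ord A} · T` with `s ∤ T`, `ord T ≤ ord A` (`T` = the strict transform of
  the hypersurface `A = 0` of the `x'`-space at the point `c` of the exceptional divisor), and the sliced chart kills no non-zero
  series (`slice_subst_chart_eq_zero_iff`);
* `exists_slice_X_mul_eq` / `slice_X_mul_eq_zero_iff` — the same in the bricks' factorised format: from `A ∘ chart(c) = s^n · B`,
  `(s · B)| = s^{ord A + 1 - n} · T` with `s ∤ T`, and `(s · B)| = 0 ↔ A = 0`.  For a double point (`d = 2`): the new linear
  coefficient is `s^{ord A₁ - 1} · T₁` (`n = 2`), the new constant coefficient is `s^{ord A₀ - 2} · T₀` (`n = 3`); in particular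
  the classes `{A₁ = 0}` (purely inseparable) and `{A₁ ≠ 0}` (separable) are successor-closed;
The curve blow-up brick is treated in the companion file `…CoeffTransportCurve.lean`.
-/

set_option linter.dupNamespace false -- mandated namespace of this single-conjunct summit

namespace Summit.ResolutionOfSingularities.ResolutionOfSingularities.Theorems

open Literature.AlgebraicGeometry.Resolution

namespace CoeffTransport

open MvPowerSeries

variable {k : Type} [Field k] {n : ℕ}

/-! ### Exponent bookkeeping for the slice -/

/-- Inserting a `0` at the slot `i₀.succ` of an exponent `(b, τ)` gives `(b, τ♮)` with `τ♮` = `τ` with a `0` inserted at `i₀`. -/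
theorem mapDomain_succ_succAbove_cons (i₀ : Fin (n + 1)) (b : ℕ) (τ : Fin n →₀ ℕ) :
    Finsupp.mapDomain i₀.succ.succAbove (Finsupp.cons b τ) =
      Finsupp.cons b (Finsupp.mapDomain i₀.succAbove τ) := by
  ext j
  refine Fin.cases ?_ (fun l => ?_) j
  · rw [Finsupp.cons_zero, show (0 : Fin (n + 2)) = i₀.succ.succAbove 0 from (Fin.succ_succAbove_zero i₀).symm,
      Finsupp.mapDomain_apply (Fin.succAbove_right_injective), Finsupp.cons_zero]
  · rw [Finsupp.cons_succ]
    rcases Fin.eq_self_or_eq_succAbove i₀ l with rfl | ⟨l', rfl⟩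
    · rw [Finsupp.mapDomain_notin_range _ _ (by simp),
        Finsupp.mapDomain_notin_range _ _ (by simp)]
    · rw [← Fin.succ_succAbove_succ, Finsupp.mapDomain_apply (Fin.succAbove_right_injective),
        Finsupp.mapDomain_apply (Fin.succAbove_right_injective), Finsupp.cons_succ]

/-- The inserted exponent vanishes at the inserted slot. -/
theorem mapDomain_succAbove_apply_self (i₀ : Fin (n + 1)) (τ : Fin n →₀ ℕ) :
    Finsupp.mapDomain i₀.succAbove τ i₀ = 0 :=
  Finsupp.mapDomain_notin_range _ _ (by simp)

/-- The inserted exponent agrees with `τ` off the inserted slot. -/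
theorem mapDomain_succAbove_apply_succAbove (i₀ : Fin (n + 1)) (τ : Fin n →₀ ℕ) (l : Fin n) :
    Finsupp.mapDomain i₀.succAbove τ (i₀.succAbove l) = τ l :=
  Finsupp.mapDomain_apply (Fin.succAbove_right_injective) _ _

/-- Deleting the slot `i₀` of an exponent and re-inserting a `0` there: the result agrees with the exponent off `i₀`. -/
theorem mapDomain_succAbove_comap (i₀ : Fin (n + 1)) (d : Fin (n + 1) →₀ ℕ) (l : Fin (n + 1)) (hl : l ≠ i₀) :
    Finsupp.mapDomain i₀.succAbove (Finsupp.equivFunOnFinite.symm (fun j => d (i₀.succAbove j))) l = d l := by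
  obtain ⟨l', rfl⟩ := Fin.exists_succAbove_eq hl
  rw [mapDomain_succAbove_apply_succAbove]
  simp

/-! ### The coefficient formula of the sliced point chart -/

/-- All weights are `1 ≠ 0`: the chart convention `w_l = 0 → c_l = 0` holds vacuously. -/
theorem chart_convention_one (c : Fin (n + 1) → k) : ∀ l, (fun _ : Fin (n + 1) => (1 : ℕ)) l = 0 → c l = 0 :=
  fun _ hl => absurd hl one_ne_zero

/-- COEFFICIENT FORMULA OF THE SLICED POINT CHART.  For `A ∈ k[[x'_0,…,x'_n]]`, the exceptional point `c` and the slot `i₀`,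
the coefficient of `s^b · x''^τ` in `(A ∘ chart(c))|_{x'_{i₀} ↦ 0}` is `Σ_{|d| = b} A_d ∏_l C(d_l, τ♮_l) c_l^{d_l - τ♮_l}`,
`τ♮` = `τ` with `0` inserted at `i₀`. -/
theorem coeff_cons_slice_subst_chart (i₀ : Fin (n + 1)) (c : Fin (n + 1) → k) (A : MvPowerSeries (Fin (n + 1)) k)
    (b : ℕ) (τ : Fin n →₀ ℕ) :
    coeff (Finsupp.cons b τ) (TupleGame.slice i₀ (subst (CobordantChart.chart (fun _ : Fin (n + 1) => 1) c) A)) =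
      ∑ᶠ d : Fin (n + 1) →₀ ℕ, if Finsupp.degree d = b then
        coeff d A * ∏ l, (((d l).choose (Finsupp.mapDomain i₀.succAbove τ l) : k) *
          c l ^ (d l - Finsupp.mapDomain i₀.succAbove τ l)) else 0 := by
  unfold TupleGame.slice
  rw [CobordantChartPlaneSlice.coeff_subst_slice, mapDomain_succ_succAbove_cons,
    CobordantChart.coeff_subst_chart _ c (chart_convention_one c)]
  refine finsum_congr fun d => ?_
  rw [← Finsupp.degree_eq_weight_one]

/-! ### `s^{ord A}` divides the sliced chart image, `s^{ord A + 1}` does not -/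

/-- Below the order of `A` every coefficient of the sliced chart image vanishes. -/
theorem coeff_cons_slice_subst_chart_eq_zero_of_lt (i₀ : Fin (n + 1)) (c : Fin (n + 1) → k)
    (A : MvPowerSeries (Fin (n + 1)) k) {b : ℕ} (hb : (b : ℕ∞) < A.order) (τ : Fin n →₀ ℕ) :
    coeff (Finsupp.cons b τ) (TupleGame.slice i₀ (subst (CobordantChart.chart (fun _ : Fin (n + 1) => 1) c) A)) = 0 := by
  rw [coeff_cons_slice_subst_chart]
  apply finsum_eq_zero_of_forall_eq_zero
  intro d
  split_ifs with hd
  · rw [coeff_of_lt_order (by rw [hd]; exact hb), zero_mul]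
  · rfl

/-- `s^ν` divides the sliced chart image whenever `ν ≤ ord A`. -/
theorem X_pow_dvd_slice_subst_chart (i₀ : Fin (n + 1)) (c : Fin (n + 1) → k) (A : MvPowerSeries (Fin (n + 1)) k)
    {ν : ℕ} (hν : (ν : ℕ∞) ≤ A.order) :
    X 0 ^ ν ∣ TupleGame.slice i₀ (subst (CobordantChart.chart (fun _ : Fin (n + 1) => 1) c) A) := by
  rw [X_pow_dvd_iff]
  intro E hE
  rw [← Finsupp.cons_tail E]
  exact coeff_cons_slice_subst_chart_eq_zero_of_lt i₀ c A (lt_of_lt_of_le (by exact_mod_cast hE) hν) _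

/-- THE TOP FORM SURVIVES.  If `c i₀ ≠ 0` and `A ≠ 0` has order `ν`, pick a degree-`ν` exponent `d⋆` of `A` with `d⋆ i₀`
minimal; then the coefficient of `s^ν · x''^{d⋆ off i₀}` in the sliced chart image is `A_{d⋆} · c_{i₀}^{d⋆ i₀} ≠ 0`
(the coefficient formula collapses: any other degree-`ν` exponent `d` of `A` has `d l < d⋆ l` for some `l ≠ i₀`). -/
theorem exists_coeff_slice_subst_chart_ne_zero (i₀ : Fin (n + 1)) (c : Fin (n + 1) → k) (hc : c i₀ ≠ 0)
    {A : MvPowerSeries (Fin (n + 1)) k} (hA : A ≠ 0) :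
    ∃ τ : Fin n →₀ ℕ, Finsupp.degree τ ≤ A.order.toNat ∧
      coeff (Finsupp.cons A.order.toNat τ)
        (TupleGame.slice i₀ (subst (CobordantChart.chart (fun _ : Fin (n + 1) => 1) c) A)) ≠ 0 := by
  classical
  have hνA : (A.order.toNat : ℕ∞) = A.order := ne_zero_iff_order_finite.mp hA
  obtain ⟨d₀, hd₀, hdeg₀⟩ := exists_coeff_ne_zero_and_order hνA
  set ν : ℕ := A.order.toNat with hνdef
  -- the degree-ν exponents in the support of `A`
  let S : Set (Fin (n + 1) →₀ ℕ) := {d | coeff d A ≠ 0 ∧ Finsupp.degree d = ν}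
  have hSfin : S.Finite := (Finsupp.finite_of_degree_le ν).subset fun d hd => le_of_eq hd.2
  have hSne : S.Nonempty := by
    refine ⟨d₀, hd₀, ?_⟩
    have h : ((Finsupp.degree d₀ : ℕ) : ℕ∞) = (ν : ℕ∞) := by rw [hνA]; exact hdeg₀
    exact_mod_cast h
  -- `d⋆`: minimal `i₀`-entry among them
  obtain ⟨dstar, hdstarS, hmin⟩ := hSfin.exists_minimalFor (fun d => d i₀) S hSne
  obtain ⟨hdstarA, hdstardeg⟩ := hdstarS
  -- `τ` := `d⋆` off `i₀`
  let τ : Fin n →₀ ℕ := Finsupp.equivFunOnFinite.symm fun j => dstar (i₀.succAbove j)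
  have hτ : ∀ l, l ≠ i₀ → Finsupp.mapDomain i₀.succAbove τ l = dstar l := fun l hl =>
    mapDomain_succAbove_comap i₀ dstar l hl
  have hτ0 : Finsupp.mapDomain i₀.succAbove τ i₀ = 0 := mapDomain_succAbove_apply_self i₀ τ
  have hτle : ∀ l, Finsupp.mapDomain i₀.succAbove τ l ≤ dstar l := fun l => by
    by_cases hl : l = i₀
    · rw [hl, hτ0]; exact Nat.zero_le _
    · rw [hτ l hl]
  refine ⟨τ, ?_, ?_⟩
  · -- degree τ = ν - d⋆ i₀ ≤ ν
    have hdeg : Finsupp.degree (Finsupp.mapDomain i₀.succAbove τ) ≤ Finsupp.degree dstar := by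
      rw [Finsupp.degree_eq_sum, Finsupp.degree_eq_sum]
      exact Finset.sum_le_sum fun l _ => hτle l
    rw [Finsupp.degree_mapDomain] at hdeg
    rw [← hdstardeg]
    exact hdeg
  · rw [coeff_cons_slice_subst_chart, finsum_eq_single _ dstar]
    · rw [if_pos hdstardeg]
      refine mul_ne_zero hdstarA ?_
      rw [Finset.prod_eq_single i₀]
      · rw [hτ0, Nat.choose_zero_right, Nat.cast_one, one_mul, Nat.sub_zero]
        exact pow_ne_zero _ hc
      · intro l _ hl
        rw [hτ l hl, Nat.choose_self, Nat.cast_one, one_mul, Nat.sub_self, pow_zero]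
      · intro h; exact absurd (Finset.mem_univ i₀) h
    · intro d hd
      split_ifs with hdeg
      · by_cases hdA : coeff d A = 0
        · rw [hdA, zero_mul]
        · -- some `l` has `d l < τ♮ l`, killing the binomial
          suffices h : ∃ l, d l < Finsupp.mapDomain i₀.succAbove τ l by
            obtain ⟨l, hl⟩ := h
            rw [Finset.prod_eq_zero (Finset.mem_univ l)
              (by rw [Nat.choose_eq_zero_of_lt hl, Nat.cast_zero, zero_mul]), mul_zero]
          by_contra hall
          push Not at hall
          -- then `d ≥ d⋆` off `i₀`, and `d i₀ ≥ d⋆ i₀` by minimality; equal degrees force `d = d⋆`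
          have hdS : d ∈ S := ⟨hdA, hdeg⟩
          have hi₀ : dstar i₀ ≤ d i₀ := by
            by_contra hlt
            push Not at hlt
            exact absurd (hmin hdS hlt.le) (not_le.mpr hlt)
          have hall' : ∀ l, dstar l ≤ d l := fun l => by
            by_cases hl : l = i₀
            · rw [hl]; exact hi₀
            · rw [← hτ l hl]; exact hall l
          apply hd
          have hsum : ∑ l, dstar l = ∑ l, d l := by
            rw [← Finsupp.degree_eq_sum, ← Finsupp.degree_eq_sum, hdstardeg, hdeg]
          ext l
          exact ((Finset.sum_eq_sum_iff_of_le fun l _ => hall' l).mp hsum l (Finset.mem_univ l)).symm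
      · rfl


/-! ### The strict transform: `(A ∘ chart(c))| = s^{ord A} · T`, `s ∤ T` -/

/-- `(ν, τ) - (ν, 0) = (0, τ)` on exponents. -/
theorem cons_sub_single (ν : ℕ) (τ : Fin n →₀ ℕ) :
    Finsupp.cons ν τ - Finsupp.single (0 : Fin (n + 1)) ν = Finsupp.cons 0 τ := by
  ext j
  refine Fin.cases ?_ (fun l => ?_) j
  · simp
  · simp [Finsupp.cons_succ, Fin.succ_ne_zero]

/-- `coeff (ν, τ) (s^ν · T) = coeff (0, τ) T`. -/
theorem coeff_cons_X_pow_mul (ν : ℕ) (τ : Fin n →₀ ℕ) (T : MvPowerSeries (Fin (n + 1)) k) :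
    coeff (Finsupp.cons ν τ) (X 0 ^ ν * T) = coeff (Finsupp.cons 0 τ) T := by
  rw [X_pow_eq, coeff_monomial_mul, if_pos (by rw [Finsupp.single_le_iff, Finsupp.cons_zero]), one_mul,
    cons_sub_single]

/-- The degree of `(0, τ)` is the degree of `τ`. -/
theorem degree_cons_zero (τ : Fin n →₀ ℕ) : Finsupp.degree (Finsupp.cons 0 τ) = Finsupp.degree τ := by
  rw [Finsupp.degree_eq_sum, Finsupp.degree_eq_sum, Fin.sum_univ_succ, Finsupp.cons_zero, zero_add]
  exact Finset.sum_congr rfl fun l _ => Finsupp.cons_succ _ _ _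

/-- THE STRICT TRANSFORM AT A POINT OF THE EXCEPTIONAL DIVISOR.  For `A ≠ 0` of order `ν` and an exceptional point `c` with
`c i₀ ≠ 0`, the sliced chart image factors as `(A ∘ chart(c))|_{x'_{i₀} ↦ 0} = s^ν · T` with `s ∤ T` and `ord T ≤ ν`:
`T` is the strict transform of the hypersurface germ `A = 0` of the `x'`-space under the blow-up of the origin, in the chart
`x'_{i₀} = c_{i₀} s`, `x'_l = s (c_l + x''_l)` centred at the point `c` of the exceptional divisor `s = 0`. -/
theorem exists_slice_subst_chart_eq (i₀ : Fin (n + 1)) (c : Fin (n + 1) → k) (hc : c i₀ ≠ 0)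
    {A : MvPowerSeries (Fin (n + 1)) k} (hA : A ≠ 0) :
    ∃ T : MvPowerSeries (Fin (n + 1)) k,
      TupleGame.slice i₀ (subst (CobordantChart.chart (fun _ : Fin (n + 1) => 1) c) A) = X 0 ^ A.order.toNat * T ∧
        ¬ (X 0 ∣ T) ∧ T.order ≤ A.order := by
  have hνA : (A.order.toNat : ℕ∞) = A.order := ne_zero_iff_order_finite.mp hA
  obtain ⟨T, hT⟩ := X_pow_dvd_slice_subst_chart i₀ c A (le_of_eq hνA)
  obtain ⟨τ, hτdeg, hcoeff⟩ := exists_coeff_slice_subst_chart_ne_zero i₀ c hc hA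
  rw [hT, coeff_cons_X_pow_mul] at hcoeff
  refine ⟨T, hT, fun hdvd => hcoeff ?_, ?_⟩
  · exact (X_dvd_iff.mp hdvd) _ (Finsupp.cons_zero _ _)
  · rw [← hνA]
    calc T.order ≤ Finsupp.degree (Finsupp.cons 0 τ) := order_le hcoeff
      _ = Finsupp.degree τ := by rw [degree_cons_zero]
      _ ≤ A.order.toNat := by exact_mod_cast hτdeg

/-- The sliced point chart kills no non-zero series (when the slot `i₀` is live, `c i₀ ≠ 0`). -/
theorem slice_subst_chart_ne_zero (i₀ : Fin (n + 1)) (c : Fin (n + 1) → k) (hc : c i₀ ≠ 0)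
    {A : MvPowerSeries (Fin (n + 1)) k} (hA : A ≠ 0) :
    TupleGame.slice i₀ (subst (CobordantChart.chart (fun _ : Fin (n + 1) => 1) c) A) ≠ 0 := by
  obtain ⟨T, hT, hndvd, -⟩ := exists_slice_subst_chart_eq i₀ c hc hA
  rw [hT]
  exact mul_ne_zero (pow_ne_zero _ (FormalCoordChange.X_ne_zero' _)) fun h => hndvd (h ▸ dvd_zero _)

/-- The tuple-game slice of `0` is `0`. -/
theorem slice_zero (i₀ : Fin (n + 1)) : TupleGame.slice i₀ (0 : MvPowerSeries (Fin (n + 1 + 1)) k) = 0 := by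
  unfold TupleGame.slice
  rw [← coe_substAlgHom (CobordantChartPlaneSlice.hasSubst_slice i₀), map_zero]

/-- INJECTIVITY OF THE SLICED POINT CHART: `(A ∘ chart(c))|_{x'_{i₀} ↦ 0} = 0 ↔ A = 0` (`c i₀ ≠ 0`). -/
theorem slice_subst_chart_eq_zero_iff (i₀ : Fin (n + 1)) (c : Fin (n + 1) → k) (hc : c i₀ ≠ 0)
    (A : MvPowerSeries (Fin (n + 1)) k) :
    TupleGame.slice i₀ (subst (CobordantChart.chart (fun _ : Fin (n + 1) => 1) c) A) = 0 ↔ A = 0 := by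
  refine ⟨fun h => by_contra fun hA => slice_subst_chart_ne_zero i₀ c hc hA h, fun h => ?_⟩
  rw [h, ← coe_substAlgHom (CobordantChart.hasSubst_chart _ c (chart_convention_one c)), map_zero, slice_zero]

/-! ### The bricks' factorised format -/

/-- TRANSPORT IN THE BRICKS' FORMAT.  If `A ∘ chart(c) = s^m · B` (as produced in `won_monic_of_pointBlowup`, `m = d - j + 1`)
with `m ≤ ord A + 1`, then the new coefficient `(s · B)|_{x'_{i₀} ↦ 0}` is `s^{ord A + 1 - m} · T` with `s ∤ T`, `ord T ≤ ord A`
(`T` the strict transform of `exists_slice_subst_chart_eq`). -/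
theorem exists_slice_X_mul_eq (i₀ : Fin (n + 1)) (c : Fin (n + 1) → k) (hc : c i₀ ≠ 0)
    {A : MvPowerSeries (Fin (n + 1)) k} (hA : A ≠ 0) {m : ℕ} {B : MvPowerSeries (Fin (n + 1 + 1)) k}
    (hfac : subst (CobordantChart.chart (fun _ : Fin (n + 1) => 1) c) A = X 0 ^ m * B) (hm : m ≤ A.order.toNat + 1) :
    ∃ T : MvPowerSeries (Fin (n + 1)) k, TupleGame.slice i₀ (X 0 * B) = X 0 ^ (A.order.toNat + 1 - m) * T ∧
      ¬ (X 0 ∣ T) ∧ T.order ≤ A.order := by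
  obtain ⟨T, hT, hndvd, hord⟩ := exists_slice_subst_chart_eq i₀ c hc hA
  refine ⟨T, ?_, hndvd, hord⟩
  have h1 : TupleGame.slice i₀ (X 0 * B) = X 0 * TupleGame.slice i₀ B := by
    rw [← pow_one (X 0 : MvPowerSeries (Fin (n + 1 + 1)) k), MultiplicityLift.slice_X_zero_pow_mul, pow_one]
  have hm' : X 0 ^ m * TupleGame.slice i₀ B = X 0 ^ A.order.toNat * T := by
    rw [← MultiplicityLift.slice_X_zero_pow_mul, ← hfac, hT]
  have hkey : X 0 ^ m * TupleGame.slice i₀ (X 0 * B) = X 0 ^ m * (X 0 ^ (A.order.toNat + 1 - m) * T) :=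
    calc X 0 ^ m * TupleGame.slice i₀ (X 0 * B) = X 0 * (X 0 ^ m * TupleGame.slice i₀ B) := by rw [h1]; ring
      _ = X 0 * (X 0 ^ A.order.toNat * T) := by rw [hm']
      _ = X 0 ^ (A.order.toNat + 1) * T := by rw [← mul_assoc, ← pow_succ']
      _ = X 0 ^ m * (X 0 ^ (A.order.toNat + 1 - m) * T) := by
        rw [← mul_assoc, ← pow_add, show m + (A.order.toNat + 1 - m) = A.order.toNat + 1 from by omega]
  exact mul_left_cancel₀ (pow_ne_zero m (FormalCoordChange.X_ne_zero' _)) hkey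

/-- In the bricks' format the new coefficient vanishes iff the old one does: `(s · B)|_{x'_{i₀} ↦ 0} = 0 ↔ A = 0`
(`A ∘ chart(c) = s^m · B`, `c i₀ ≠ 0`).  In particular for double points `y² + A₁ y + A₀` the classes `{A₁ = 0}` and
`{A₁ ≠ 0}` are closed under the point blow-up brick. -/
theorem slice_X_mul_eq_zero_iff (i₀ : Fin (n + 1)) (c : Fin (n + 1) → k) (hc : c i₀ ≠ 0)
    (A : MvPowerSeries (Fin (n + 1)) k) {m : ℕ} {B : MvPowerSeries (Fin (n + 1 + 1)) k}
    (hfac : subst (CobordantChart.chart (fun _ : Fin (n + 1) => 1) c) A = X 0 ^ m * B) :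
    TupleGame.slice i₀ (X 0 * B) = 0 ↔ A = 0 := by
  have h1 : TupleGame.slice i₀ (X 0 * B) = X 0 * TupleGame.slice i₀ B := by
    rw [← pow_one (X 0 : MvPowerSeries (Fin (n + 1 + 1)) k), MultiplicityLift.slice_X_zero_pow_mul, pow_one]
  have h2 : TupleGame.slice i₀ (subst (CobordantChart.chart (fun _ : Fin (n + 1) => 1) c) A) =
      X 0 ^ m * TupleGame.slice i₀ B := by
    rw [hfac, MultiplicityLift.slice_X_zero_pow_mul]
  rw [← slice_subst_chart_eq_zero_iff i₀ c hc A, h1, h2, mul_eq_zero, mul_eq_zero]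
  simp [FormalCoordChange.X_ne_zero']

/-- THE `A₁`-TRANSPORT (double points, `d = 2`, `j = 1`: `A₁ ∘ chart(c) = s² · B₁`).  If `A₁ ≠ 0` has `ord A₁ ≥ 2`, the new
linear coefficient `(s · B₁)|_{x'_{i₀} ↦ 0}` of the point blow-up brick is `s^{ord A₁ - 1} · T₁` with `s ∤ T₁`, `ord T₁ ≤ ord A₁`,
`T₁` the strict transform of the plane curve germ `A₁ = 0` at the exceptional point. -/
theorem exists_linearCoeff_transport (i₀ : Fin (n + 1)) (c : Fin (n + 1) → k) (hc : c i₀ ≠ 0)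
    {A₁ : MvPowerSeries (Fin (n + 1)) k} (hA₁ : A₁ ≠ 0) (hord : (1 : ℕ∞) < A₁.order)
    {B₁ : MvPowerSeries (Fin (n + 1 + 1)) k}
    (hfac : subst (CobordantChart.chart (fun _ : Fin (n + 1) => 1) c) A₁ = X 0 ^ 2 * B₁) :
    ∃ T₁ : MvPowerSeries (Fin (n + 1)) k, TupleGame.slice i₀ (X 0 * B₁) = X 0 ^ (A₁.order.toNat - 1) * T₁ ∧
      ¬ (X 0 ∣ T₁) ∧ T₁.order ≤ A₁.order := by
  have hνA : (A₁.order.toNat : ℕ∞) = A₁.order := ne_zero_iff_order_finite.mp hA₁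
  have h2 : 2 ≤ A₁.order.toNat := by
    have h : (1 : ℕ∞) < (A₁.order.toNat : ℕ∞) := by rw [hνA]; exact hord
    have h' : 1 < A₁.order.toNat := by exact_mod_cast h
    omega
  obtain ⟨T, hT, hndvd, hordT⟩ := exists_slice_X_mul_eq i₀ c hc hA₁ hfac (by omega)
  exact ⟨T, by rw [show A₁.order.toNat - 1 = A₁.order.toNat + 1 - 2 from by omega]; exact hT, hndvd, hordT⟩

/-- THE `A₀`-TRANSPORT (double points, `d = 2`, `j = 0`: `A₀ ∘ chart(c) = s³ · B₀`).  If `A₀ ≠ 0` has `ord A₀ ≥ 3`, the new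
constant coefficient `(s · B₀)|_{x'_{i₀} ↦ 0}` of the point blow-up brick is `s^{ord A₀ - 2} · T₀` with `s ∤ T₀`, `ord T₀ ≤ ord A₀`. -/
theorem exists_constCoeff_transport (i₀ : Fin (n + 1)) (c : Fin (n + 1) → k) (hc : c i₀ ≠ 0)
    {A₀ : MvPowerSeries (Fin (n + 1)) k} (hA₀ : A₀ ≠ 0) (hord : (2 : ℕ∞) < A₀.order)
    {B₀ : MvPowerSeries (Fin (n + 1 + 1)) k}
    (hfac : subst (CobordantChart.chart (fun _ : Fin (n + 1) => 1) c) A₀ = X 0 ^ 3 * B₀) :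
    ∃ T₀ : MvPowerSeries (Fin (n + 1)) k, TupleGame.slice i₀ (X 0 * B₀) = X 0 ^ (A₀.order.toNat - 2) * T₀ ∧
      ¬ (X 0 ∣ T₀) ∧ T₀.order ≤ A₀.order := by
  have hνA : (A₀.order.toNat : ℕ∞) = A₀.order := ne_zero_iff_order_finite.mp hA₀
  have h3 : 3 ≤ A₀.order.toNat := by
    have h : (2 : ℕ∞) < (A₀.order.toNat : ℕ∞) := by rw [hνA]; exact hord
    have h' : 2 < A₀.order.toNat := by exact_mod_cast h
    omega
  obtain ⟨T, hT, hndvd, hordT⟩ := exists_slice_X_mul_eq i₀ c hc hA₀ hfac (by omega)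
  exact ⟨T, by rw [show A₀.order.toNat - 2 = A₀.order.toNat + 1 - 3 from by omega]; exact hT, hndvd, hordT⟩


end CoeffTransport

end Summit.ResolutionOfSingularities.ResolutionOfSingularities.Theorems
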